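import Summits.KontsevichZagierPeriods.KontsevichZagierPeriods.Theorems.HurwitzMicroSectorsNormalFormPrincipleM4SimplexFacts
import Summits.KontsevichZagierPeriods.KontsevichZagierPeriods.Theorems.FurushoPentagonHoffmanRelationInKZCubicalTransportAux

/-!
# `NormalFormPrinciple` (stmt-KontsevichZagierPeriods-3869), line `SketchIdeator1` —
# leaf `stub_boxRigidity`, layer `M4` toolkit: the open unit cube is the decreasing simplex `Δ₄`

Pure proof file (registered sub-goal `m4_box_sub_simplex4` of the line `SketchIdeator1`, lead
seat c9, layer `M4` toolkit — the dimension-four campaign of the leaf `stub_boxRigidity`;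
`--supports` the crux). The CUBICAL CHART

  `C(x₀, x₁, x₂, x₃) = (x₀, x₀x₁, x₀x₁x₂, x₀x₁x₂x₃)`

is a monomial chart in the sense of `FurushoPentagon.HoffmanRelationInKZ.monomialChart_transport`
(rows `S i = {j ≤ i}`, lower-triangular Jacobian with determinant `x₀³x₁²x₂ > 0` on the cube): it is
injective on the open unit cube `□⁴ = (0,1)⁴` (successive cancellation of positive factors) and maps
it ONTO the decreasing open simplex `Δ₄ = {0 < t₃ < t₂ < t₁ < t₀ < 1}` (inverse
`t ↦ (t₀, t₁/t₀, t₂/t₁, t₃/t₂)`). Hence, for an arbitrary integrand `g` of a representation `T` on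
`Δ₄`, ONE change of variables of the Kontsevich–Zagier calculus (rule (2),
`KZ.changeOfVariablesRel`) identifies `T` with every representation `N` on `□⁴` whose integrand is
the pull-back `g (C x) · x₀³x₁²x₂` there (part 1), and such an `N` exists — semialgebraicity by
composition, absolute integrability transported along the chart (part 2). Both parts are read off
`monomialChart_transport`; this file only supplies the concrete rows, the Jacobian, injectivity and
the image of the chart in dimension four.

References: M. Kontsevich, D. Zagier, *Periods* (2001), §1.1–1.2, rule (2). No definitions are
introduced.
-/

noncomputable section

open MeasureTheory Set
open Literature.NumberTheory.Transcendental Literature.NumberTheory.Transcendental.KZ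
open Literature.ModelTheory.ExponentialFields (IsSemialgebraic)
open Summit.KontsevichZagierPeriods.FurushoPentagon.HoffmanRelationInKZ (monomialChart_transport)

namespace Summit.KontsevichZagierPeriods.HurwitzMicroSectors.NormalFormPrinciple.PiBox.M3

/-! ## The cubical chart of `□⁴`: rows, Jacobian, injectivity, image -/

/-- The components of the cubical chart `(x₀, x₀x₁, x₀x₁x₂, x₀x₁x₂x₃)` are the partial products
`∏_{j ≤ i} x_j` (rows of a monomial chart). [folklore] -/
theorem m4c_cubicalChart_apply (y : Fin 4 → ℝ) (i : Fin 4) :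
    (![y 0, y 0 * y 1, y 0 * y 1 * y 2, y 0 * y 1 * y 2 * y 3] : Fin 4 → ℝ) i =
      ∏ j ∈ Finset.univ.filter (fun j : Fin 4 => j ≤ i), y j := by
  rw [Finset.prod_filter, Fin.prod_univ_four]
  match i with
  | 0 => simp
  | 1 => simp
  | 2 => simp
  | 3 => simp

/-- The Jacobian determinant of the cubical chart (product of the diagonal entries
`∏_{k < i} x_k` of its lower-triangular derivative) is `x₀³ x₁² x₂`. [folklore] -/
theorem m4c_jacobian (y : Fin 4 → ℝ) :
    ∏ i : Fin 4, ∏ k ∈ (Finset.univ.filter (fun j : Fin 4 => j ≤ i)).erase i, y k =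
      y 0 ^ 3 * y 1 ^ 2 * y 2 := by
  have hE : ∀ i : Fin 4, (Finset.univ.filter (fun j : Fin 4 => j ≤ i)).erase i =
      Finset.univ.filter (fun j : Fin 4 => j < i) := by
    intro i
    ext k
    simp only [Finset.mem_erase, Finset.mem_filter, Finset.mem_univ, true_and]
    exact ⟨fun h => lt_of_le_of_ne h.2 h.1, fun h => ⟨h.ne, h.le⟩⟩
  simp only [hE, Finset.prod_filter, Fin.prod_univ_four, Fin.reduceLT, if_true, if_false, mul_one,
    one_mul]
  ring

/-- The cubical chart is injective on the open unit cube (successive cancellation of the positive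
factors `x₀`, `x₀x₁`, `x₀x₁x₂`). [folklore] -/
theorem m4c_injOn :
    InjOn (fun x : Fin 4 → ℝ =>
        (![x 0, x 0 * x 1, x 0 * x 1 * x 2, x 0 * x 1 * x 2 * x 3] : Fin 4 → ℝ))
      {x : Fin 4 → ℝ | ∀ i, x i ∈ Set.Ioo (0:ℝ) 1} := by
  intro x _ y hy hxy
  have e0 : x 0 = y 0 := congrFun hxy 0
  have e1 : x 0 * x 1 = y 0 * y 1 := congrFun hxy 1
  have e2 : x 0 * x 1 * x 2 = y 0 * y 1 * y 2 := congrFun hxy 2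
  have e3 : x 0 * x 1 * x 2 * x 3 = y 0 * y 1 * y 2 * y 3 := congrFun hxy 3
  have hy0 : y 0 ≠ 0 := (hy 0).1.ne'
  have hy01 : y 0 * y 1 ≠ 0 := mul_ne_zero hy0 (hy 1).1.ne'
  have hy012 : y 0 * y 1 * y 2 ≠ 0 := mul_ne_zero hy01 (hy 2).1.ne'
  rw [e0] at e1
  have h1 : x 1 = y 1 := mul_left_cancel₀ hy0 e1
  rw [e0, h1] at e2
  have h2 : x 2 = y 2 := mul_left_cancel₀ hy01 e2
  rw [e0, h1, h2] at e3
  have h3 : x 3 = y 3 := mul_left_cancel₀ hy012 e3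
  funext i
  match i with
  | 0 => exact e0
  | 1 => exact h1
  | 2 => exact h2
  | 3 => exact h3

/-- **The cubical chart maps `□⁴` onto `Δ₄`**: products of numbers of `(0,1)` decrease strictly and
stay positive; conversely `t ↦ (t₀, t₁/t₀, t₂/t₁, t₃/t₂)` is an inverse on `Δ₄`. [folklore] -/
theorem m4c_image :
    (fun x : Fin 4 → ℝ =>
        (![x 0, x 0 * x 1, x 0 * x 1 * x 2, x 0 * x 1 * x 2 * x 3] : Fin 4 → ℝ)) ''
        {x : Fin 4 → ℝ | ∀ i, x i ∈ Set.Ioo (0:ℝ) 1} =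
      {t | 0 < t 3 ∧ t 3 < t 2 ∧ t 2 < t 1 ∧ t 1 < t 0 ∧ t 0 < 1} := by
  ext t
  constructor
  · rintro ⟨x, hx, rfl⟩
    have h0 : 0 < x 0 := (hx 0).1
    have h01 : 0 < x 0 * x 1 := mul_pos h0 (hx 1).1
    have h012 : 0 < x 0 * x 1 * x 2 := mul_pos h01 (hx 2).1
    refine ⟨?_, ?_, ?_, ?_, ?_⟩
    · show 0 < x 0 * x 1 * x 2 * x 3
      exact mul_pos h012 (hx 3).1
    · show x 0 * x 1 * x 2 * x 3 < x 0 * x 1 * x 2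
      exact mul_lt_of_lt_one_right h012 (hx 3).2
    · show x 0 * x 1 * x 2 < x 0 * x 1
      exact mul_lt_of_lt_one_right h01 (hx 2).2
    · show x 0 * x 1 < x 0
      exact mul_lt_of_lt_one_right h0 (hx 1).2
    · show x 0 < 1
      exact (hx 0).2
  · rintro ⟨h3, h32, h21, h10, h0⟩
    have ht2 : 0 < t 2 := h3.trans h32
    have ht1 : 0 < t 1 := ht2.trans h21
    have ht0 : 0 < t 0 := ht1.trans h10
    have e1 : t 0 * (t 1 / t 0) = t 1 := mul_div_cancel₀ _ ht0.ne'
    have e2 : t 0 * (t 1 / t 0) * (t 2 / t 1) = t 2 := by rw [e1, mul_div_cancel₀ _ ht1.ne']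
    have e3 : t 0 * (t 1 / t 0) * (t 2 / t 1) * (t 3 / t 2) = t 3 := by
      rw [e2, mul_div_cancel₀ _ ht2.ne']
    refine ⟨![t 0, t 1 / t 0, t 2 / t 1, t 3 / t 2], ?_, ?_⟩
    · intro i
      match i with
      | 0 => exact ⟨ht0, h0⟩
      | 1 => exact ⟨div_pos ht1 ht0, (div_lt_one ht0).2 h10⟩
      | 2 => exact ⟨div_pos ht2 ht1, (div_lt_one ht1).2 h21⟩
      | 3 => exact ⟨div_pos h3 ht2, (div_lt_one ht2).2 h32⟩
    · funext i
      match i with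
      | 0 => rfl
      | 1 => exact e1
      | 2 => exact e2
      | 3 => exact e3

/-- The pull-back identity of the cubical chart on `□⁴`: `g (C x) · x₀³x₁²x₂ = g (C x) · |Jac C(x)|`
(the Jacobian is positive on the cube). [folklore] -/
theorem m4c_pullback (g : (Fin 4 → ℝ) → ℝ) :
    ∀ y ∈ {x : Fin 4 → ℝ | ∀ i, x i ∈ Set.Ioo (0:ℝ) 1},
      g ![y 0, y 0 * y 1, y 0 * y 1 * y 2, y 0 * y 1 * y 2 * y 3] * (y 0 ^ 3 * y 1 ^ 2 * y 2) =
        g ![y 0, y 0 * y 1, y 0 * y 1 * y 2, y 0 * y 1 * y 2 * y 3] *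
          |∏ i : Fin 4, ∏ k ∈ (Finset.univ.filter (fun j : Fin 4 => j ≤ i)).erase i, y k| := by
  intro y hy
  rw [m4c_jacobian,
    abs_of_pos (mul_pos (mul_pos (pow_pos (hy 0).1 3) (pow_pos (hy 1).1 2)) (hy 2).1)]

/-! ## The registered sub-goal -/

/-- **Stub `m4_box_sub_simplex4` (registered sub-goal of stmt-KontsevichZagierPeriods-3869, line
`SketchIdeator1`, layer `M4` toolkit).** The cubical substitution
`(x₀,x₁,x₂,x₃) ↦ (x₀, x₀x₁, x₀x₁x₂, x₀x₁x₂x₃)` (rule 2, Jacobian `x₀³x₁²x₂`) of the open unit cube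
`□⁴ = (0,1)⁴` onto the decreasing open simplex `Δ₄ = {0 < t₃ < t₂ < t₁ < t₀ < 1}`, for an ARBITRARY
integrand `g` of a representation `T` on `Δ₄`: (1) every representation `N` on `□⁴` with
`N.integrand x = g (C x) · x₀³x₁²x₂` there satisfies `of N − of T ∈ relations` — ONE
change-of-variables move `KZ.changeOfVariablesRel` of the Kontsevich–Zagier calculus; (2) such a box
carrier `N` exists (semialgebraicity by composition with the polynomial chart, absolute
integrability transported along it). Both by `monomialChart_transport`.
[cite: KontsevichZagier2001, §1.2 rule (2)] -/
theorem m4_box_sub_simplex4 :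
    (∀ (g : (Fin 4 → ℝ) → ℝ) (N T : IntegralRep 4),
      N.domain = {x | ∀ i, x i ∈ Set.Ioo (0:ℝ) 1} →
      T.domain = {t | 0 < t 3 ∧ t 3 < t 2 ∧ t 2 < t 1 ∧ t 1 < t 0 ∧ t 0 < 1} →
      EqOn T.integrand g T.domain →
      EqOn N.integrand (fun x => g ![x 0, x 0 * x 1, x 0 * x 1 * x 2, x 0 * x 1 * x 2 * x 3] *
        (x 0 ^ 3 * x 1 ^ 2 * x 2)) N.domain →
      of N - of T ∈ relations) ∧
    (∀ (g : (Fin 4 → ℝ) → ℝ) (T : IntegralRep 4),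
      T.domain = {t | 0 < t 3 ∧ t 3 < t 2 ∧ t 2 < t 1 ∧ t 1 < t 0 ∧ t 0 < 1} →
      EqOn T.integrand g T.domain →
      ∃ N : IntegralRep 4, N.domain = {x | ∀ i, x i ∈ Set.Ioo (0:ℝ) 1} ∧
        N.integrand = fun x => g ![x 0, x 0 * x 1, x 0 * x 1 * x 2, x 0 * x 1 * x 2 * x 3] *
          (x 0 ^ 3 * x 1 ^ 2 * x 2)) := by
  -- the rows `S i = {j ≤ i}` of the monomial chart
  have hS : ∀ i : Fin 4, ∀ j ∈ Finset.univ.filter (fun j : Fin 4 => j ≤ i), j ≤ i :=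
    fun i j hj => (Finset.mem_filter.mp hj).2
  have hS' : ∀ i : Fin 4, i ∈ Finset.univ.filter (fun j : Fin 4 => j ≤ i) := fun i =>
    Finset.mem_filter.mpr ⟨Finset.mem_univ _, le_rfl⟩
  -- ONE monomial-chart transport, for each integrand `g`
  have key := fun g : (Fin 4 → ℝ) → ℝ =>
    monomialChart_transport (fun i : Fin 4 => Finset.univ.filter (fun j : Fin 4 => j ≤ i)) hS hS'
      (isSemialgebraic_box 4)
      (fun x : Fin 4 → ℝ =>
        (![x 0, x 0 * x 1, x 0 * x 1 * x 2, x 0 * x 1 * x 2 * x 3] : Fin 4 → ℝ))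
      m4c_cubicalChart_apply m4c_injOn
      (fun x : Fin 4 → ℝ => g ![x 0, x 0 * x 1, x 0 * x 1 * x 2, x 0 * x 1 * x 2 * x 3] *
        (x 0 ^ 3 * x 1 ^ 2 * x 2)) g (m4c_pullback g)
  refine ⟨fun g N T hNd hTd hTg hNi => ?_, fun g T hTd hTg => ?_⟩
  · -- part 1: the move `of N − of T ∈ relations` (`KZ.Equivalent N T` unfolds to it)
    exact (key g).2 N T hNd (by rw [← hNd]; exact hNi) (hTd.trans m4c_image.symm) hTg
  · -- part 2: existence of the box carrier
    exact (key g).1 T (hTd.trans m4c_image.symm) hTg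

end Summit.KontsevichZagierPeriods.HurwitzMicroSectors.NormalFormPrinciple.PiBox.M3
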